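import Summits.CriticalPhenomena.PercolationContinuityZ3.Theorems.Transplant.FKConnectivityAllQAntipodalDefs
import HarnessLib

/-!
# Connectivity correlation inequalities for `φ_{w,q}`, every `q > 0` — file 22 (DEFINITION): antipodal functionals WITH A CONTRACTED SET
# (all coefficients, not only the square-free ones)

Definitions file (`--supports stmt-CriticalPhenomena-4575`), FK sub-lane `prim-bschramm-fk-2` (gen 11) of the post-continuity
programme; builds on p205010 (kernel theorem, internal audit signed; external expert review pending).  No named facts, no sorries.

`…AntipodalDefs.lean` attached to an edge set `E` the antipodal sums over complementary pairs `(γ, E \ γ)`; they are the SQUARE-FREE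
coefficients of `Z_H(z)² Cov_{φ_{z,q}}(f,g)` (edge odds `z`).  A general coefficient, of the monomial `z^{2·1_C + 1_M}` (`C ⊔ M ⊔ D = E(H)`: the
edges open in BOTH samples, in exactly ONE, in NEITHER), is the same kind of sum for the minor `H / C \ D`: with `γ ⊆ M` the two samples are
`ω = C ∪ γ`, `ω' = C ∪ (M \ γ)`, and `k_{H/C\D}(γ) = k_H(γ ∪ C)` — contraction never needs a quotient vertex type, only the union with `C`
inside the cluster count.  This file fixes the three functionals with the contracted set `C` made explicit (for `C = ∅` they are literally
those of `…AntipodalDefs.lean`):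
* `FK.apExpC E C γ = k(γ ∪ C) + k((E \ γ) ∪ C)`;
* `FK.apUpcC q E C s t h = ∑_{γ ⊆ E} q^{apExpC} (1{s↔t in γ ∪ C} - 1{s↔t in (E\γ) ∪ C}) h(γ)`;
* `FK.apPsiC q E C f g = ∑_{γ ⊆ E} q^{apExpC} (f(γ ∪ C) - f((E\γ) ∪ C)) (g(γ ∪ C) - g((E\γ) ∪ C))` — for increasing `f, g` with disjoint
  supports, twice the coefficient of `z^{2·1_C + 1_E}` in `Z_H² Cov_{φ_{z,q}}(f,g)` for every `H ⊇ E ⊔ C`.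
The sibling `…AntipodalMinorUpc.lean` proves `0 ≤ apUpcC` on two-terminal series–parallel networks for every `q > 0` (the induction of
`…AntipodalUpc.lean` verbatim, the contracted set riding along inside both members of the pair) and hence, for `0 < q ≤ 1`, `apPsiC ≤ 0` for `f`
the indicator of one or two edges: EVERY coefficient of `Z² Cov_{φ_{z,q}}(ω_x, g)` is `≤ 0` on series–parallel graphs (gen 10's Conjecture C_∞ at
`|supp f| ≤ 2`; false for `K₄`).
[cite: Grimmett2006, §1.4 eq. (1.20) (p. 15); §3.8 (pp. 61–62)] [cite: Wagner2006, Thm. 5.8(d), §5.3]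
-/

noncomputable section

namespace Summit.CriticalPhenomena.PercolationContinuityZ3.Theorems

namespace FK

open Literature.Probability.LatticeModels Literature.Probability.Percolation
open scoped Classical

variable {V : Type*}

/-- **Antipodal cluster exponent with contracted set** `apExpC E C γ = k(γ ∪ C) + k((E \ γ) ∪ C)` — the exponent of the minor `· / C`
(`C` open in both members of the pair; Grimmett 2006, (1.20) for `k`). [cite: Grimmett2006, §1.4 eq. (1.20) (p. 15)] -/
def apExpC (E C γ : Finset (Sym2 V)) : ℕ :=
  clusterCount (↑(γ ∪ C) : BondConfig V) ∅ + clusterCount (↑(E \ γ ∪ C) : BondConfig V) ∅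

/-- **Antipodal up-correlation functional with contracted set**:
`apUpcC q E C s t h = ∑_{γ ⊆ E} q^{k(γ∪C)+k((E\γ)∪C)} · (1{s ↔ t in γ ∪ C} - 1{s ↔ t in (E \ γ) ∪ C}) · h(γ)`.
[cite: Grimmett2006, §1.4 eq. (1.20) (p. 15); §3.8 (pp. 61–62)] -/
def apUpcC (q : ℝ) (E C : Finset (Sym2 V)) (s t : V) (h : Finset (Sym2 V) → ℝ) : ℝ :=
  ∑ γ ∈ E.powerset, q ^ apExpC E C γ * ((apConn (γ ∪ C) s t - apConn (E \ γ ∪ C) s t) * h γ)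

/-- **Antipodal covariance form with contracted set**:
`apPsiC q E C f g = ∑_{γ ⊆ E} q^{k(γ∪C)+k((E\γ)∪C)} (f(γ ∪ C) - f((E\γ) ∪ C)) (g(γ ∪ C) - g((E\γ) ∪ C))` — twice the coefficient of
`z^{2·1_C + 1_E}` in `Z_H(z)² Cov_{φ_{z,q}}(f, g)` (`H ⊇ E ⊔ C`, `f, g` increasing with disjoint supports).
[cite: Grimmett2006, §1.4 eq. (1.20) (p. 15); §3.8 (pp. 61–62)] [cite: Wagner2006, Thm. 5.8(d), §5.3] -/
def apPsiC (q : ℝ) (E C : Finset (Sym2 V)) (f g : Finset (Sym2 V) → ℝ) : ℝ :=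
  ∑ γ ∈ E.powerset, q ^ apExpC E C γ * ((f (γ ∪ C) - f (E \ γ ∪ C)) * (g (γ ∪ C) - g (E \ γ ∪ C)))

end FK

end Summit.CriticalPhenomena.PercolationContinuityZ3.Theorems

end
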